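import Literature.AnabelianGeometry.SemiGraphs.PSCGraphicity
import Mathlib.Tactic.Group

/-!
# What a graphic isomorphism preserves ([CombGC] Def. 1.4, Prop. 1.5 (ii) ⇒), proved over the interface

Mochizuki, *A combinatorial version of the Grothendieck conjecture*, Tohoku Math. J. **59** (2007)
[CombGC], §1, Definition 1.4 (i)–(iv) (pp. 10–11) and Proposition 1.5 (ii) (p. 13): "`α` is
graphic if and only if it is group-theoretically edge-like and group-theoretically verticial".
`PSCGraphicity.lean` types these over the interface `PSCDatum Π`; this proof-only companion
discharges, for EVERY pair of data and every `α : Π_G ≅ Π_H`, the immediate implication: a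
GRAPHIC `α` (Def. 1.4 (i): it carries the conjugacy class of each `Π_v`, `Π_e`, `Π_c` onto that of
`Π_{ι v}`, `Π_{ι e}`, `Π_{ι c}` for an isomorphism `ι` of underlying semi-graphs) is
group-theoretically verticial, edge-like and cuspidal (Def. 1.4 (iv)), and numerically cuspidal
(Def. 1.4 (ii)) — cusp by cusp, `#(U \ Π / Π_c) = #(α U \ Π' / Π'_{ι c})`; graphicity is reflexive.
[cite: MochizukiCombGC2007, Prop 1.5(ii) p.13]

The converse (Prop. 1.5 (ii) ⇐, the uniqueness of `ι`, Thm. 1.6) uses the geometric origin of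
`G` (Prop. 1.2) and stays a named fact over `Ω : PSCOrigin`; the easy directions of Thm. 1.6 (ii),
(iii) are the L5 companion files of seat abc-iut-L5-t6.  Pure proofs; no definitions; nothing
here takes a side on [IUTchIII] Cor. 3.12.
-/

noncomputable section

namespace Literature.AnabelianGeometry.SemiGraphs

namespace PSCDatum

open scoped Pointwise

universe u

variable {P : Type u} [Group P] [TopologicalSpace P]

/-! ### Double-coset counts under conjugation and transport -/

section DoubleCosets

omit [TopologicalSpace P] in
/-- Double-coset counts do not see the choice of representative in a conjugacy class:
`#(H \ Π / γKγ⁻¹) = #(H \ Π / K)` (the cusps over `c` are defined through the conjugacy CLASS of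
`Π_c`, [CombGC] Def. 1.1 (ii), p. 6). [cite: MochizukiCombGC2007, Def 1.1(ii) p.6] -/
theorem card_doubleCoset_quotient_conj (H K : Subgroup P) (γ : ConjAct P) :
    Nat.card (DoubleCoset.Quotient (H : Set P) ((γ • K : Subgroup P) : Set P)) =
      Nat.card (DoubleCoset.Quotient (H : Set P) (K : Set P)) := by
  set g : P := ConjAct.ofConjAct γ with hg
  refine Nat.card_congr (Quotient.congr (Equiv.mulRight g) fun x y => ?_)
  simp only [Equiv.coe_mulRight]
  rw [DoubleCoset.rel_iff, DoubleCoset.rel_iff]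
  constructor
  · rintro ⟨a, ha, b, hb, rfl⟩
    obtain ⟨b', hb', rfl⟩ := (Subgroup.mem_smul_pointwise_iff_exists b γ K).mp hb
    refine ⟨a, ha, b', hb', ?_⟩
    rw [ConjAct.smul_def, ← hg]
    group
  · rintro ⟨a, ha, b', hb', h⟩
    refine ⟨a, ha, γ • b', Subgroup.smul_mem_pointwise_smul b' γ K hb', ?_⟩
    rw [ConjAct.smul_def, ← hg]
    calc y = y * g * g⁻¹ := by group
      _ = a * (x * g) * b' * g⁻¹ := by rw [h]
      _ = a * x * (g * b' * g⁻¹) := by group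

omit [TopologicalSpace P] in
/-- Double-coset counts are transported by a group isomorphism. [cite: MochizukiCombGC2007, Def 1.4(ii) p.10] -/
theorem card_doubleCoset_quotient_map {P' : Type u} [Group P'] (α : P ≃* P') (H K : Subgroup P) :
    Nat.card (DoubleCoset.Quotient ((H.map α.toMonoidHom : Subgroup P') : Set P')
      ((K.map α.toMonoidHom : Subgroup P') : Set P')) =
      Nat.card (DoubleCoset.Quotient (H : Set P) (K : Set P)) := by
  symm
  refine Nat.card_congr (Quotient.congr α.toEquiv fun x y => ?_)
  rw [DoubleCoset.rel_iff, DoubleCoset.rel_iff]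
  constructor
  · rintro ⟨a, ha, b, hb, rfl⟩
    exact ⟨α a, Subgroup.mem_map_of_mem _ ha, α b, Subgroup.mem_map_of_mem _ hb, by simp⟩
  · rintro ⟨a', ha', b', hb', h⟩
    obtain ⟨a, ha, rfl⟩ := Subgroup.mem_map.mp ha'
    obtain ⟨b, hb, rfl⟩ := Subgroup.mem_map.mp hb'
    refine ⟨a, ha, b, hb, α.injective ?_⟩
    simpa using h

end DoubleCosets

/-! ### Definition 1.4 / Proposition 1.5 (ii), p. 13: what a graphic isomorphism preserves -/

section Graphic

variable (G : PSCDatum P)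
variable {P' : Type u} [Group P'] [TopologicalSpace P']

omit [TopologicalSpace P] [TopologicalSpace P'] in
/-- Images of conjugates: `f(γSγ⁻¹) = f(γ) f(S) f(γ)⁻¹`. [cite: MochizukiCombGC2007, Def 1.4(i) p.10] -/
theorem map_conj_smul (f : P →* P') (γ : ConjAct P) (S : Subgroup P) :
    (γ • S).map f = ConjAct.toConjAct (f (ConjAct.ofConjAct γ)) • S.map f := by
  ext x
  simp only [Subgroup.mem_map, Subgroup.mem_smul_pointwise_iff_exists, ConjAct.smul_def,
    ConjAct.ofConjAct_toConjAct]
  constructor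
  · rintro ⟨y, ⟨s, hs, rfl⟩, rfl⟩
    exact ⟨f s, ⟨s, hs, rfl⟩, by simp [map_mul, map_inv]⟩
  · rintro ⟨y, ⟨s, hs, rfl⟩, rfl⟩
    exact ⟨ConjAct.ofConjAct γ * s * (ConjAct.ofConjAct γ)⁻¹, ⟨s, hs, rfl⟩, by simp [map_mul, map_inv]⟩

variable {G} {H : PSCDatum P'} {α : P ≃ₜ* P'}

/-- The transport pattern behind Prop. 1.5 (ii) ⇒: if `α` carries the class of each `S v` onto the
class of `T (ι v)` for a bijection `ι`, then `α` maps the `Π`-conjugates of the `S v` onto the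
`Π'`-conjugates of the `T w`, and every such conjugate arises. [cite: MochizukiCombGC2007, Prop 1.5(ii) p.13] -/
theorem transport_conj_classes {ιV ιW : Type} (e : ιV ≃ ιW) (S : ιV → Subgroup P)
    (T : ιW → Subgroup P')
    (h : ∀ v, ∃ γ : ConjAct P', (S v).map α.toMulEquiv.toMonoidHom = γ • T (e v)) :
    (∀ A : Subgroup P, (∃ (v : ιV) (γ : ConjAct P), A = γ • S v) →
        ∃ (w : ιW) (γ : ConjAct P'), A.map α.toMulEquiv.toMonoidHom = γ • T w) ∧
      ∀ B : Subgroup P', (∃ (w : ιW) (γ : ConjAct P'), B = γ • T w) →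
        ∃ A : Subgroup P, (∃ (v : ιV) (γ : ConjAct P), A = γ • S v) ∧
          A.map α.toMulEquiv.toMonoidHom = B := by
  constructor
  · rintro A ⟨v, γ, rfl⟩
    obtain ⟨δ, hδ⟩ := h v
    refine ⟨e v, ConjAct.toConjAct (α (ConjAct.ofConjAct γ)) * δ, ?_⟩
    rw [map_conj_smul, hδ, mul_smul]
    rfl
  · rintro B ⟨w, γ, rfl⟩
    obtain ⟨δ, hδ⟩ := h (e.symm w)
    rw [e.apply_symm_apply] at hδ
    set g : P' := ConjAct.ofConjAct (γ * δ⁻¹) with hg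
    refine ⟨ConjAct.toConjAct (α.symm g) • S (e.symm w), ⟨e.symm w, _, rfl⟩, ?_⟩
    rw [map_conj_smul, hδ, ConjAct.ofConjAct_toConjAct, ← mul_smul]
    have hα : α.toMulEquiv.toMonoidHom (α.symm g) = g := α.apply_symm_apply g
    rw [hα, hg, ConjAct.toConjAct_ofConjAct, inv_mul_cancel_right]

/-- **[CombGC] Prop. 1.5 (ii) ⇒, verticial part**: a graphic `α` (via `ι`) is group-theoretically
verticial. [cite: MochizukiCombGC2007, Prop 1.5(ii) p.13] -/
theorem IsGraphicVia.isGroupTheoreticallyVerticial {ι : PSCSemiGraph.Iso G.graph H.graph}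
    (h : G.IsGraphicVia H α ι) : G.IsGroupTheoreticallyVerticial H α := by
  obtain ⟨h₁, h₂⟩ := transport_conj_classes ι.vertEquiv G.vertGp H.vertGp h.1
  exact ⟨fun A hA => by obtain ⟨w, γ, hw⟩ := h₁ A hA; exact ⟨w, γ, hw⟩,
    fun B hB => by obtain ⟨A, hA, hAB⟩ := h₂ B hB; exact ⟨A, hA, hAB⟩⟩

/-- **[CombGC] Prop. 1.5 (ii) ⇒, cuspidal part**: a graphic `α` is group-theoretically cuspidal.
[cite: MochizukiCombGC2007, Prop 1.5(ii) p.13] -/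
theorem IsGraphicVia.isGroupTheoreticallyCuspidal {ι : PSCSemiGraph.Iso G.graph H.graph}
    (h : G.IsGraphicVia H α ι) : G.IsGroupTheoreticallyCuspidal H α := by
  obtain ⟨h₁, h₂⟩ := transport_conj_classes ι.cuspEquiv G.cuspGp H.cuspGp h.2.2
  exact ⟨fun A hA => by obtain ⟨w, γ, hw⟩ := h₁ A hA; exact ⟨w, γ, hw⟩,
    fun B hB => by obtain ⟨A, hA, hAB⟩ := h₂ B hB; exact ⟨A, hA, hAB⟩⟩

/-- A graphic `α` maps nodal subgroups onto nodal subgroups, all of which arise.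
[cite: MochizukiCombGC2007, Prop 1.5(ii) p.13] -/
theorem IsGraphicVia.isNodal_transport {ι : PSCSemiGraph.Iso G.graph H.graph}
    (h : G.IsGraphicVia H α ι) :
    (∀ A, G.IsNodal A → H.IsNodal (A.map α.toMulEquiv.toMonoidHom)) ∧
      ∀ B, H.IsNodal B → ∃ A, G.IsNodal A ∧ A.map α.toMulEquiv.toMonoidHom = B := by
  obtain ⟨h₁, h₂⟩ := transport_conj_classes ι.nodeEquiv G.nodeGp H.nodeGp h.2.1
  exact ⟨fun A hA => by obtain ⟨w, γ, hw⟩ := h₁ A hA; exact ⟨w, γ, hw⟩,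
    fun B hB => by obtain ⟨A, hA, hAB⟩ := h₂ B hB; exact ⟨A, hA, hAB⟩⟩

/-- **[CombGC] Prop. 1.5 (ii) ⇒, edge-like part**: a graphic `α` is group-theoretically
edge-like. [cite: MochizukiCombGC2007, Prop 1.5(ii) p.13] -/
theorem IsGraphicVia.isGroupTheoreticallyEdgeLike {ι : PSCSemiGraph.Iso G.graph H.graph}
    (h : G.IsGraphicVia H α ι) : G.IsGroupTheoreticallyEdgeLike H α := by
  obtain ⟨n₁, n₂⟩ := h.isNodal_transport
  obtain ⟨c₁, c₂⟩ := h.isGroupTheoreticallyCuspidal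
  refine ⟨fun A hA => ?_, fun B hB => ?_⟩
  · rcases hA with hA | hA
    · exact Or.inl (n₁ A hA)
    · exact Or.inr (c₁ A hA)
  · rcases hB with hB | hB
    · obtain ⟨A, hA, hAB⟩ := n₂ B hB
      exact ⟨A, Or.inl hA, hAB⟩
    · obtain ⟨A, hA, hAB⟩ := c₂ B hB
      exact ⟨A, Or.inr hA, hAB⟩

/-- **[CombGC] Prop. 1.5 (ii), the immediate implication** "graphic ⟹ group-theoretically
edge-like and group-theoretically verticial" (p. 13), for all data.
[cite: MochizukiCombGC2007, Prop 1.5(ii) p.13] -/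
theorem IsGraphic.isGroupTheoreticallyEdgeLike_and_verticial (h : G.IsGraphic H α) :
    G.IsGroupTheoreticallyEdgeLike H α ∧ G.IsGroupTheoreticallyVerticial H α := by
  obtain ⟨ι, hι⟩ := h
  exact ⟨hι.isGroupTheoreticallyEdgeLike, hι.isGroupTheoreticallyVerticial⟩

/-- A graphic `α` is group-theoretically cuspidal (Def. 1.4 (iv)). [cite: MochizukiCombGC2007, Def 1.4(iv) p.11] -/
theorem IsGraphic.isGroupTheoreticallyCuspidal (h : G.IsGraphic H α) :
    G.IsGroupTheoreticallyCuspidal H α := by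
  obtain ⟨ι, hι⟩ := h
  exact hι.isGroupTheoreticallyCuspidal

/-- A graphic `α` is numerically cuspidal (Def. 1.4 (ii)): corresponding coverings have the same
number of cusps — indeed `#(U \ Π / Π_c) = #(α U \ Π' / Π'_{ι c})` cusp by cusp.
[cite: MochizukiCombGC2007, Def 1.4(ii) p.10] -/
theorem IsGraphic.isNumericallyCuspidal (h : G.IsGraphic H α) : G.IsNumericallyCuspidal H α := by
  obtain ⟨ι, -, -, hc⟩ := h
  intro U _
  unfold cuspCount
  rw [← Equiv.sum_comp ι.cuspEquiv]
  refine Finset.sum_congr rfl fun c _ => ?_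
  obtain ⟨δ, hδ⟩ := hc c
  have : H.cuspGp (ι.cuspEquiv c) = δ⁻¹ • (G.cuspGp c).map α.toMulEquiv.toMonoidHom := by
    rw [hδ, inv_smul_smul]
  rw [this, card_doubleCoset_quotient_conj, card_doubleCoset_quotient_map]

/-- Graphicity is reflexive: the identity of `Π_G` is graphic via the identity of the underlying
semi-graph. [cite: MochizukiCombGC2007, Def 1.4(i) p.10] -/
theorem isGraphic_refl (G : PSCDatum P) : G.IsGraphic G (ContinuousMulEquiv.refl P) := by
  refine ⟨⟨Equiv.refl _, Equiv.refl _, Equiv.refl _, fun e => ?_, fun c => rfl⟩, ?_, ?_, ?_⟩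
  · simp
  all_goals
    intro x
    refine ⟨1, ?_⟩
    rw [one_smul]
    exact Subgroup.map_id _

end Graphic

end PSCDatum

end Literature.AnabelianGeometry.SemiGraphs

end
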